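import Mathlib
import Summits.Ventures.PercRepro2.Defs
import Summits.Ventures.PercRepro2.Independence
import Summits.Ventures.PercRepro2.Harris
import Summits.Ventures.PercRepro2.Graph
import Summits.Ventures.PercRepro2.Exploration
import Summits.Ventures.PercRepro2.Events
import Summits.Ventures.PercRepro2.FourFunctions
import Summits.Ventures.PercRepro2.Induced
import Summits.Ventures.PercRepro2.Frontier
import Summits.Ventures.PercRepro2.ObsIndependence
import Summits.Ventures.PercRepro2.BHK
import Summits.Ventures.PercRepro2.BHKEvents
import Summits.Ventures.PercRepro2.VdBKahn
import Summits.Ventures.PercRepro2.BHKAvoid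
import Summits.Ventures.PercRepro2.R2PrimeThreeReduction
import Summits.Ventures.PercRepro2.YBridge
import Summits.Ventures.PercRepro2.Yu1Functionals
import Summits.Ventures.PercRepro2.Yu1Events
import Summits.Ventures.PercRepro2.Yu1
import Summits.Ventures.PercRepro2.LBSplit
import Summits.Ventures.PercRepro2.YDelta
import Summits.Ventures.PercRepro2.Step0

/-!
# The monotone light-density family (blind cell PercRepro2, typer-1; lead g7 ADDENDUM 17 (13)(2),
CONJECTURES rows 2′MONO / 2′STEP0)

On `Q = {a₁ ↮ a₂}` (`avoidAll a₂ {a₁}`), for an avoided set `A : Finset V`: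

* `Dfam A = P(Q, A ∩ (C₁ ∪ C₂) = ∅)`, `Wfam A = P(Q, b ∈ C₂, A ∩ C₁ = ∅) − P(Q, b ∈ C₁, A ∩ C₁ = ∅, A ∩ C₂ ≠ ∅)`
  (`ρ(A) = Wfam A / Dfam A` is the light density of `A`);
* `MonoStep A v := Wfam A · Dfam (insert v A) ≤ Wfam (insert v A) · Dfam A` — "`ρ` is non-decreasing
  at the step `A → A ∪ {v}`"; `MonoFam := ∀ A v, MonoStep A v` (row 2′MONO).

Identifications: `Dfam_empty`, `Wfam_empty`, `Dfam_a3 = P(PD)`, `Wfam_a3 = W`, and the two rungs of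
the ladder `∅ → {a₃} → {a₃, o}`:
* **`monoStep_empty`** — the base step `∅ → {v}` is a THEOREM under the labelling (= `Step0.step0`);
* **`monoStep_a3_iff`** — the step `{a₃} → {a₃, o}` is exactly `Z_0 + Z_h ≥ 0` in its Lean-ready
  form `D_o · W ≥ D · [T_{l→h} + T_{h→l} + Δ_T^o]` (`ZExpand.Z0ZhNonneg_iff`; the lead's "L2 IS the
  monotonicity step").
-/

namespace Summit.Ventures.PercRepro2

open UnionCluster Yu1

namespace MonoFamily

section Defs

variable {V : Type*} {E : Type*} [Fintype E] [DecidableEq E] [DecidableEq V] {R : Type*} [Field R]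

/-- `Dfam A = P(Q, A ∩ (C₁ ∪ C₂) = ∅)`. -/
noncomputable def Dfam (p : E → R) (ends : E → Sym2 V) (a₁ a₂ : V) (A : Finset V) : R :=
  prob p (avoidAll ends a₂ {a₁} ∩ avoidAll ends a₁ A ∩ avoidAll ends a₂ A)

/-- `Wfam A = P(Q, b ∈ C₂, A ∩ C₁ = ∅) − P(Q, b ∈ C₁, A ∩ C₁ = ∅, A ∩ C₂ ≠ ∅)`. -/
noncomputable def Wfam (p : E → R) (ends : E → Sym2 V) (a₁ a₂ b : V) (A : Finset V) : R :=
  prob p (avoidAll ends a₂ {a₁} ∩ connEvent ends a₂ b ∩ avoidAll ends a₁ A) -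
    prob p (avoidAll ends a₂ {a₁} ∩ connEvent ends a₁ b ∩ avoidAll ends a₁ A ∩
      (avoidAll ends a₂ A)ᶜ)

end Defs

section Props

variable {V : Type*} {E : Type*} [Fintype E] [DecidableEq E] [DecidableEq V] {R : Type*} [Field R]
  [LinearOrder R]

/-- **The monotonicity step** `A → A ∪ {v}`: `ρ(A) ≤ ρ(A ∪ {v})`, cleared —
`Wfam A · Dfam (A ∪ {v}) ≤ Wfam (A ∪ {v}) · Dfam A`. -/
def MonoStep (p : E → R) (ends : E → Sym2 V) (a₁ a₂ b : V) (A : Finset V) (v : V) : Prop :=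
  Wfam p ends a₁ a₂ b A * Dfam p ends a₁ a₂ (insert v A) ≤
    Wfam p ends a₁ a₂ b (insert v A) * Dfam p ends a₁ a₂ A

/-- **Row 2′MONO**: every step is monotone. -/
def MonoFam (p : E → R) (ends : E → Sym2 V) (a₁ a₂ b : V) : Prop :=
  ∀ (A : Finset V) (v : V), MonoStep p ends a₁ a₂ b A v

end Props

section Closures

variable (R : Type*) [Field R] [LinearOrder R] [IsStrictOrderedRing R]

/-- **Row 2′MONO for every finite graph** under the labelling `P(b ↔ a₁) ≤ P(b ↔ a₂)`. -/
def MonoFam_all : Prop :=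
  ∀ (V E : Type) [Fintype V] [DecidableEq V] [Fintype E] [DecidableEq E]
    (ends : E → Sym2 V) (p : E → R), IsProbVec p →
    ∀ a₁ a₂ b : V, a₁ ≠ a₂ → b ≠ a₁ → b ≠ a₂ →
      prob p (connEvent ends a₁ b) ≤ prob p (connEvent ends a₂ b) →
      MonoFam p ends a₁ a₂ b

end Closures

section Base

variable {V : Type*} {E : Type*} [Fintype E] [DecidableEq E] [Fintype V] [DecidableEq V]
  {R : Type*} [Field R] [LinearOrder R] [IsStrictOrderedRing R]

omit [Fintype V] [DecidableEq V] [LinearOrder R] [IsStrictOrderedRing R] in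
/-- `Dfam ∅ = P(Q)`. -/
lemma Dfam_empty (p : E → R) (ends : E → Sym2 V) (a₁ a₂ : V) :
    Dfam p ends a₁ a₂ ∅ = prob p (avoidAll ends a₂ {a₁}) := by
  unfold Dfam
  have e : avoidAll ends a₂ {a₁} ∩ avoidAll ends a₁ ∅ ∩ avoidAll ends a₂ ∅ = avoidAll ends a₂ {a₁} := by
    ext ω
    simp [avoidAll]
  rw [e]

omit [Fintype V] [DecidableEq V] [LinearOrder R] [IsStrictOrderedRing R] in
/-- `Wfam ∅ = P(Q, b ∈ C₂)`. -/
lemma Wfam_empty (p : E → R) (ends : E → Sym2 V) (a₁ a₂ b : V) :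
    Wfam p ends a₁ a₂ b ∅ = prob p (connEvent ends a₂ b ∩ avoidAll ends a₂ {a₁}) := by
  unfold Wfam
  have e1 : avoidAll ends a₂ {a₁} ∩ connEvent ends a₂ b ∩ avoidAll ends a₁ ∅ =
      connEvent ends a₂ b ∩ avoidAll ends a₂ {a₁} := by
    ext ω
    simp only [avoidAll, Set.mem_inter_iff, Set.mem_setOf_eq, Finset.notMem_empty, false_imp_iff,
      implies_true, and_true]
    tauto
  have e2 : avoidAll ends a₂ {a₁} ∩ connEvent ends a₁ b ∩ avoidAll ends a₁ ∅ ∩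
      (avoidAll ends a₂ ∅)ᶜ = ∅ := by
    ext ω
    simp [avoidAll]
  rw [e1, e2, prob_empty, sub_zero]

omit [Fintype V] [DecidableEq V] [LinearOrder R] [IsStrictOrderedRing R] in
/-- `Dfam {v} = P(Q, v ∉ C₁, v ∉ C₂) = P(Q) − P(Q, v ∈ C₁) − P(Q, v ∈ C₂)`. -/
lemma Dfam_singleton (p : E → R) (ends : E → Sym2 V) (a₁ a₂ v : V) :
    Dfam p ends a₁ a₂ {v} =
      prob p (avoidAll ends a₂ {a₁}) - prob p (connEvent ends a₁ v ∩ avoidAll ends a₂ {a₁}) -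
        prob p (connEvent ends a₂ v ∩ avoidAll ends a₂ {a₁}) := by
  unfold Dfam
  have s1 := prob_inter_add_prob_inter_compl p (avoidAll ends a₂ {a₁}) (connEvent ends a₁ v)
  have s2 := prob_inter_add_prob_inter_compl p (avoidAll ends a₂ {a₁} ∩ (connEvent ends a₁ v)ᶜ)
    (connEvent ends a₂ v)
  have e1 : avoidAll ends a₂ {a₁} ∩ connEvent ends a₁ v = connEvent ends a₁ v ∩ avoidAll ends a₂ {a₁} :=
    Set.inter_comm _ _
  have e2 : avoidAll ends a₂ {a₁} ∩ (connEvent ends a₁ v)ᶜ ∩ connEvent ends a₂ v =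
      connEvent ends a₂ v ∩ avoidAll ends a₂ {a₁} := by
    ext ω
    simp only [Set.mem_inter_iff, Set.mem_compl_iff, mem_connEvent, avoidAll, Set.mem_setOf_eq,
      Finset.mem_singleton, forall_eq]
    constructor
    · rintro ⟨⟨hQ, _⟩, h2⟩
      exact ⟨h2, hQ⟩
    · rintro ⟨h2, hQ⟩
      exact ⟨⟨hQ, fun h1 => hQ (conn_trans h2 (conn_symm h1))⟩, h2⟩
  have e3 : avoidAll ends a₂ {a₁} ∩ (connEvent ends a₁ v)ᶜ ∩ (connEvent ends a₂ v)ᶜ =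
      avoidAll ends a₂ {a₁} ∩ avoidAll ends a₁ {v} ∩ avoidAll ends a₂ {v} := by
    ext ω
    simp only [Set.mem_inter_iff, Set.mem_compl_iff, mem_connEvent, avoidAll, Set.mem_setOf_eq,
      Finset.mem_singleton, forall_eq]
  rw [e1] at s1
  rw [e2, e3] at s2
  linear_combination s1 + s2

omit [Fintype V] [DecidableEq V] [LinearOrder R] [IsStrictOrderedRing R] in
/-- `Wfam {v} = [P(Q, b ∈ C₂) − P(Q, b ∈ C₂, v ∈ C₁)] − P(Q, b ∈ C₁, v ∈ C₂)`. -/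
lemma Wfam_singleton (p : E → R) (ends : E → Sym2 V) (a₁ a₂ b v : V) :
    Wfam p ends a₁ a₂ b {v} =
      prob p (connEvent ends a₂ b ∩ avoidAll ends a₂ {a₁}) -
        prob p (connEvent ends a₂ b ∩ connEvent ends a₁ v ∩ avoidAll ends a₂ {a₁}) -
        prob p (connEvent ends a₂ v ∩ connEvent ends a₁ b ∩ avoidAll ends a₂ {a₁}) := by
  unfold Wfam
  have s1 := prob_inter_add_prob_inter_compl p (connEvent ends a₂ b ∩ avoidAll ends a₂ {a₁})
    (connEvent ends a₁ v)
  have e1 : connEvent ends a₂ b ∩ avoidAll ends a₂ {a₁} ∩ (connEvent ends a₁ v)ᶜ =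
      avoidAll ends a₂ {a₁} ∩ connEvent ends a₂ b ∩ avoidAll ends a₁ {v} := by
    ext ω
    simp only [Set.mem_inter_iff, Set.mem_compl_iff, avoidAll, Set.mem_setOf_eq,
      Finset.mem_singleton, forall_eq, mem_connEvent]
    tauto
  have e2 : avoidAll ends a₂ {a₁} ∩ connEvent ends a₁ b ∩ avoidAll ends a₁ {v} ∩
      (avoidAll ends a₂ {v})ᶜ = connEvent ends a₂ v ∩ connEvent ends a₁ b ∩ avoidAll ends a₂ {a₁} := by
    ext ω
    simp only [Set.mem_inter_iff, Set.mem_compl_iff, avoidAll, Set.mem_setOf_eq,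
      Finset.mem_singleton, forall_eq, mem_connEvent, not_not]
    constructor
    · rintro ⟨⟨⟨hQ, hb⟩, _⟩, hv⟩
      exact ⟨⟨hv, hb⟩, hQ⟩
    · rintro ⟨⟨hv, hb⟩, hQ⟩
      exact ⟨⟨⟨hQ, hb⟩, fun h1 => hQ (conn_trans hv (conn_symm h1))⟩, hv⟩
  have e3 : connEvent ends a₂ b ∩ avoidAll ends a₂ {a₁} ∩ connEvent ends a₁ v =
      connEvent ends a₂ b ∩ connEvent ends a₁ v ∩ avoidAll ends a₂ {a₁} := by
    ext ω
    simp only [Set.mem_inter_iff]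
    tauto
  rw [e1, e3] at s1
  rw [e2]
  linear_combination s1

/-- **The base step `∅ → {v}` is a theorem** under the labelling (= `Step0.step0`). -/
theorem monoStep_empty (p : E → R) (hp : IsProbVec p) (ends : E → Sym2 V) {a₁ a₂ b : V}
    (hord : prob p (connEvent ends a₁ b) ≤ prob p (connEvent ends a₂ b)) (v : V) :
    MonoStep p ends a₁ a₂ b ∅ v := by
  unfold MonoStep
  simp only [Finset.insert_empty]
  rw [Dfam_empty, Wfam_empty, Dfam_singleton, Wfam_singleton]
  have h := Step0.step0 p hp ends (v := v) hord
  nlinarith [h]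

end Base

section A3

variable {V : Type*} {E : Type*} [Fintype E] [DecidableEq E] [Fintype V] [DecidableEq V]
  {R : Type*} [Field R] [LinearOrder R] [IsStrictOrderedRing R]

omit [Fintype V] [DecidableEq V] [LinearOrder R] [IsStrictOrderedRing R] in
/-- `Dfam {a₃} = P(PD)`. -/
lemma Dfam_a3 (p : E → R) (ends : E → Sym2 V) (a₁ a₂ a₃ : V) :
    Dfam p ends a₁ a₂ {a₃} = prob p (PDEvent ends a₁ a₂ a₃) := by
  unfold Dfam
  congr 1
  ext ω
  simp only [Set.mem_inter_iff, avoidAll, Set.mem_setOf_eq, Finset.mem_singleton, forall_eq,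
    PDEvent, Dtilde, inU, Set.mem_compl_iff, Set.mem_union, mem_connEvent, not_or]
  have h12 : Conn ends ω a₂ a₁ ↔ Conn ends ω a₁ a₂ := ⟨conn_symm, conn_symm⟩
  have h13 : Conn ends ω a₁ a₃ ↔ Conn ends ω a₃ a₁ := ⟨conn_symm, conn_symm⟩
  have h23 : Conn ends ω a₂ a₃ ↔ Conn ends ω a₃ a₂ := ⟨conn_symm, conn_symm⟩
  tauto

omit [Fintype V] [LinearOrder R] [IsStrictOrderedRing R] in
/-- `Wfam {a₃} = W = M₂ + Δ_T` (`= N_h − r_b`). -/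
lemma Wfam_a3 (p : E → R) (ends : E → Sym2 V) (a₁ a₂ a₃ b : V) :
    Wfam p ends a₁ a₂ b {a₃} = massM2 p ends a₁ a₂ a₃ b + deltaT p ends a₁ a₂ a₃ b := by
  unfold Wfam
  have hN := Nh_eq p ends a₁ a₂ a₃ b
  unfold deltaT
  have e1 : avoidAll ends a₂ {a₁} ∩ connEvent ends a₂ b ∩ avoidAll ends a₁ {a₃} =
      connEvent ends a₂ b ∩ avoidAll ends a₁ {a₂, a₃} := by
    ext ω
    simp only [Set.mem_inter_iff, avoidAll, Set.mem_setOf_eq, Finset.mem_singleton, forall_eq,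
      Finset.mem_insert, forall_eq_or_imp, mem_connEvent]
    have h12 : Conn ends ω a₂ a₁ ↔ Conn ends ω a₁ a₂ := ⟨conn_symm, conn_symm⟩
    tauto
  have e2 : avoidAll ends a₂ {a₁} ∩ connEvent ends a₁ b ∩ avoidAll ends a₁ {a₃} ∩
      (avoidAll ends a₂ {a₃})ᶜ = connEvent ends a₁ b ∩ TEvent ends a₁ a₂ a₃ := by
    ext ω
    simp only [Set.mem_inter_iff, Set.mem_compl_iff, avoidAll, Set.mem_setOf_eq,
      Finset.mem_singleton, forall_eq, mem_connEvent, not_not, TEvent]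
    have h13 : Conn ends ω a₁ a₃ → Conn ends ω a₂ a₃ → Conn ends ω a₂ a₁ :=
      fun h1 h2 => conn_trans h2 (conn_symm h1)
    tauto
  rw [e1, e2]
  linear_combination hN

end A3

section A3o

variable {V : Type*} {E : Type*} [Fintype E] [DecidableEq E] [Fintype V] [DecidableEq V]
  {R : Type*} [Field R] [LinearOrder R] [IsStrictOrderedRing R]

omit [Fintype V] [LinearOrder R] [IsStrictOrderedRing R] in
/-- `Dfam {o, a₃} = P(PD) − P(PD, o ∈ C₁) − P(PD, o ∈ C₂)`. -/
lemma Dfam_a3o (p : E → R) (ends : E → Sym2 V) (o a₁ a₂ a₃ : V) :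
    Dfam p ends a₁ a₂ (insert o {a₃}) =
      prob p (PDEvent ends a₁ a₂ a₃) - prob p (PDEvent ends a₁ a₂ a₃ ∩ connEvent ends a₁ o) -
        prob p (PDEvent ends a₁ a₂ a₃ ∩ connEvent ends a₂ o) := by
  unfold Dfam
  have s1 := prob_inter_add_prob_inter_compl p (PDEvent ends a₁ a₂ a₃) (connEvent ends a₁ o)
  have s2 := prob_inter_add_prob_inter_compl p (PDEvent ends a₁ a₂ a₃ ∩ (connEvent ends a₁ o)ᶜ)
    (connEvent ends a₂ o)
  have e2 : PDEvent ends a₁ a₂ a₃ ∩ (connEvent ends a₁ o)ᶜ ∩ connEvent ends a₂ o =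
      PDEvent ends a₁ a₂ a₃ ∩ connEvent ends a₂ o := by
    ext ω
    simp only [Set.mem_inter_iff, Set.mem_compl_iff, mem_connEvent, PDEvent, Dtilde, inU,
      Set.mem_union, not_or]
    have h : Conn ends ω a₂ o → Conn ends ω a₁ o → Conn ends ω a₁ a₂ :=
      fun h2 h1 => conn_trans h1 (conn_symm h2)
    tauto
  have e3 : PDEvent ends a₁ a₂ a₃ ∩ (connEvent ends a₁ o)ᶜ ∩ (connEvent ends a₂ o)ᶜ =
      avoidAll ends a₂ {a₁} ∩ avoidAll ends a₁ (insert o {a₃}) ∩ avoidAll ends a₂ (insert o {a₃}) := by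
    ext ω
    simp only [Set.mem_inter_iff, Set.mem_compl_iff, mem_connEvent, PDEvent, Dtilde, inU,
      Set.mem_union, not_or, avoidAll, Set.mem_setOf_eq, Finset.mem_insert, Finset.mem_singleton,
      forall_eq_or_imp, forall_eq]
    have h12 : Conn ends ω a₂ a₁ ↔ Conn ends ω a₁ a₂ := ⟨conn_symm, conn_symm⟩
    have h13 : Conn ends ω a₁ a₃ ↔ Conn ends ω a₃ a₁ := ⟨conn_symm, conn_symm⟩
    have h23 : Conn ends ω a₂ a₃ ↔ Conn ends ω a₃ a₂ := ⟨conn_symm, conn_symm⟩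
    tauto
  rw [e2, e3] at s2
  linear_combination s1 + s2

omit [Fintype V] [LinearOrder R] [IsStrictOrderedRing R] in
/-- `Wfam {o, a₃} = W − T_{l→h} − T_{h→l} − Δ_T^o`,
`Δ_T^o = P(T, o ∈ C₁, b ∈ C₂) − P(T, o ∈ C₁, b ∈ C₁)`. -/
lemma Wfam_a3o (p : E → R) (ends : E → Sym2 V) (o a₁ a₂ a₃ b : V) :
    Wfam p ends a₁ a₂ b (insert o {a₃}) =
      (massM2 p ends a₁ a₂ a₃ b + deltaT p ends a₁ a₂ a₃ b) -
        prob p (PDEvent ends a₁ a₂ a₃ ∩ connEvent ends a₁ o ∩ connEvent ends a₂ b) -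
        prob p (PDEvent ends a₁ a₂ a₃ ∩ connEvent ends a₂ o ∩ connEvent ends a₁ b) -
        (prob p (TEvent ends a₁ a₂ a₃ ∩ connEvent ends a₁ o ∩ connEvent ends a₂ b) -
          prob p (TEvent ends a₁ a₂ a₃ ∩ connEvent ends a₁ o ∩ connEvent ends a₁ b)) := by
  unfold Wfam
  have hN := Nh_eq p ends a₁ a₂ a₃ b
  unfold deltaT
  -- first term: `P(b ∈ C₂, R, o ∉ C₁) = N_h − P(o ∈ C₁, b ∈ C₂, R)`
  have s1 := prob_inter_add_prob_inter_compl p (connEvent ends a₂ b ∩ avoidAll ends a₁ {a₂, a₃})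
    (connEvent ends a₁ o)
  have e1 : connEvent ends a₂ b ∩ avoidAll ends a₁ {a₂, a₃} ∩ (connEvent ends a₁ o)ᶜ =
      avoidAll ends a₂ {a₁} ∩ connEvent ends a₂ b ∩ avoidAll ends a₁ (insert o {a₃}) := by
    ext ω
    simp only [Set.mem_inter_iff, Set.mem_compl_iff, avoidAll, Set.mem_setOf_eq, Finset.mem_insert,
      Finset.mem_singleton, forall_eq_or_imp, forall_eq, mem_connEvent]
    have h12 : Conn ends ω a₂ a₁ ↔ Conn ends ω a₁ a₂ := ⟨conn_symm, conn_symm⟩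
    tauto
  have e1' : connEvent ends a₂ b ∩ avoidAll ends a₁ {a₂, a₃} ∩ connEvent ends a₁ o =
      connEvent ends a₁ o ∩ connEvent ends a₂ b ∩ avoidAll ends a₁ {a₂, a₃} := by
    ext ω
    simp only [Set.mem_inter_iff]
    tauto
  have hob := prob_PD_add_T_ob p ends o a₁ a₂ a₃ b
  -- second term: `P(b ∈ C₁, R, o ∉ C₁, (a₃ ∈ C₂ ∨ o ∈ C₂)) = [r_b − P(T, o ∈ C₁, b ∈ C₁)] + T_{h→l}`
  have s2 := prob_inter_add_prob_inter_compl p (avoidAll ends a₂ {a₁} ∩ connEvent ends a₁ b ∩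
    avoidAll ends a₁ (insert o {a₃}) ∩ (avoidAll ends a₂ (insert o {a₃}))ᶜ) (connEvent ends a₂ a₃)
  have e2 : avoidAll ends a₂ {a₁} ∩ connEvent ends a₁ b ∩ avoidAll ends a₁ (insert o {a₃}) ∩
      (avoidAll ends a₂ (insert o {a₃}))ᶜ ∩ connEvent ends a₂ a₃ =
      connEvent ends a₁ b ∩ TEvent ends a₁ a₂ a₃ ∩ (connEvent ends a₁ o)ᶜ := by
    ext ω
    simp only [Set.mem_inter_iff, Set.mem_compl_iff, avoidAll, Set.mem_setOf_eq, Finset.mem_insert,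
      Finset.mem_singleton, forall_eq_or_imp, forall_eq, mem_connEvent, TEvent, not_and, not_not]
    have h13 : Conn ends ω a₁ a₃ → Conn ends ω a₂ a₃ → Conn ends ω a₂ a₁ :=
      fun h1 h2 => conn_trans h2 (conn_symm h1)
    tauto
  have e3 : avoidAll ends a₂ {a₁} ∩ connEvent ends a₁ b ∩ avoidAll ends a₁ (insert o {a₃}) ∩
      (avoidAll ends a₂ (insert o {a₃}))ᶜ ∩ (connEvent ends a₂ a₃)ᶜ =
      PDEvent ends a₁ a₂ a₃ ∩ connEvent ends a₂ o ∩ connEvent ends a₁ b := by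
    ext ω
    simp only [Set.mem_inter_iff, Set.mem_compl_iff, avoidAll, Set.mem_setOf_eq, Finset.mem_insert,
      Finset.mem_singleton, forall_eq_or_imp, forall_eq, mem_connEvent, PDEvent, Dtilde, inU,
      Set.mem_union, not_or, not_and, not_not]
    have h12 : Conn ends ω a₂ a₁ ↔ Conn ends ω a₁ a₂ := ⟨conn_symm, conn_symm⟩
    have h13 : Conn ends ω a₁ a₃ ↔ Conn ends ω a₃ a₁ := ⟨conn_symm, conn_symm⟩
    have h23 : Conn ends ω a₂ a₃ ↔ Conn ends ω a₃ a₂ := ⟨conn_symm, conn_symm⟩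
    have ho : Conn ends ω a₂ o → Conn ends ω a₁ o → Conn ends ω a₁ a₂ :=
      fun h2 h1 => conn_trans h1 (conn_symm h2)
    tauto
  have s3 := prob_inter_add_prob_inter_compl p (connEvent ends a₁ b ∩ TEvent ends a₁ a₂ a₃)
    (connEvent ends a₁ o)
  have e4 : connEvent ends a₁ b ∩ TEvent ends a₁ a₂ a₃ ∩ connEvent ends a₁ o =
      TEvent ends a₁ a₂ a₃ ∩ connEvent ends a₁ o ∩ connEvent ends a₁ b := by
    ext ω
    simp only [Set.mem_inter_iff]
    tauto
  rw [e1, e1'] at s1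
  rw [e2, e3] at s2
  rw [e4] at s3
  linear_combination s1 + hob + hN + s2 - s3

omit [Fintype V] in
/-- **The step `{a₃} → {a₃, o}` is L2** (ADDENDUM 17 (13)(2)): `MonoStep {a₃} o` is exactly
`D · [T_{l→h} + T_{h→l} + Δ_T^o] ≤ (D_l + D_h) · W`, the Lean-ready form of `Z_0 + Z_h ≥ 0`
(`ZExpand.Z0ZhNonneg_iff`). -/
theorem monoStep_a3_iff (p : E → R) (ends : E → Sym2 V) (o a₁ a₂ a₃ b : V) :
    MonoStep p ends a₁ a₂ b {a₃} o ↔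
      prob p (PDEvent ends a₁ a₂ a₃) *
          (prob p (PDEvent ends a₁ a₂ a₃ ∩ connEvent ends a₁ o ∩ connEvent ends a₂ b) +
            prob p (PDEvent ends a₁ a₂ a₃ ∩ connEvent ends a₂ o ∩ connEvent ends a₁ b) +
            (prob p (TEvent ends a₁ a₂ a₃ ∩ connEvent ends a₁ o ∩ connEvent ends a₂ b) -
              prob p (TEvent ends a₁ a₂ a₃ ∩ connEvent ends a₁ o ∩ connEvent ends a₁ b))) ≤
        (prob p (PDEvent ends a₁ a₂ a₃ ∩ connEvent ends a₁ o) +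
            prob p (PDEvent ends a₁ a₂ a₃ ∩ connEvent ends a₂ o)) *
          (massM2 p ends a₁ a₂ a₃ b + deltaT p ends a₁ a₂ a₃ b) := by
  unfold MonoStep
  rw [Dfam_a3, Wfam_a3, Dfam_a3o, Wfam_a3o]
  constructor
  · intro h
    nlinarith [h]
  · intro h
    nlinarith [h]

end A3o

end MonoFamily

end Summit.Ventures.PercRepro2
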